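import Summits.NavierStokesRegularity.NavierStokesRegularity.Theses.ExtremiserTransience
import Summits.NavierStokesRegularity.NavierStokesRegularity.Theorems.ExtremiserTransienceBangBangCoreDefs
import Summits.NavierStokesRegularity.NavierStokesRegularity.Theorems.ExtremiserTransienceZoneTransversalityDefs
import Summits.NavierStokesRegularity.NavierStokesRegularity.Theorems.ExtremiserTransienceLocalMaximiserDefs
import Summits.NavierStokesRegularity.NavierStokesRegularity.Theorems.ExtremiserTransienceLocalMaximiserLimitDefs
import Summits.NavierStokesRegularity.NavierStokesRegularity.Theorems.ExtremiserTransienceTwoThirdsExtraction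
import Summits.NavierStokesRegularity.NavierStokesRegularity.Theorems.ExtremiserTransienceTwoThirdsExtractionLarge
import HarnessLib

/-!
# Route `ExtremiserTransience`, crux `NearExtremalTransiencePerFlow` (stmt-NavierStokesRegularity-26567):
# LINE g10-1 «two thirds» (ideator ns-idea-10, generation 10, lens «rescuer»)

REV 1.4 (THE AGREED SWITCH, one edit): S1b′ ★ LANDED BY NAME — p726488 `Theorems/ExtremiserTransienceTwoThirdsExtractionLarge.lean`
`…Theorems.NearExtremalTransiencePerFlow.TwoThirds.extremalExtractionLarge : ExtremalExtractionLarge` (prover ns-net-p2 g12; texts of record p725367 =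
§2′ VERBATIM, token-compared CONFORM 11/11 by idea-crit-4 g10; std axioms) — so, per idea-crit-4's 14:07:21Z procedure and idea-crit-8's V138
concurrence, the REGISTERED stubs now read: S1a′ `stub_typicalSelection : Sig.TypicalSelectionLarge` (L, OPEN — the ns-net-p2 lineage's target;
alias `stub_typicalSelection'`), S1b′ `stub_extremalExtraction : Sig.ExtremalExtractionLarge := …extremalExtractionLarge` (★ landed term; alias
`stub_extremalExtraction'`), S2 `stub_firstOrderIdentity : Sig.FirstOrderIdentity` (M, OPEN); the skeleton `NearExtremalTransiencePerFlow_skeleton` is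
`NearExtremalTransiencePerFlow_of_large stub_typicalSelection stub_extremalExtraction stub_firstOrderIdentity` (composition PROVED in REV 1.3).  The REV ≤ 1.3
texts `Sig.TypicalSelection` (S1a, stronger: `i₁ = 0`) and `Sig.ExtremalExtraction` (S1b) stay in §2 as record, with `Sig.typicalSelectionLarge_of`
(S1a ⇒ S1a′), `Sig.extremalExtraction_of_large` (S1b′ ⇒ S1b), the landed S1b term `extremalExtraction_landed`, and the old composition
`NearExtremalTransiencePerFlow_of` (S1a → S1b → S2 → crux) all kernel-checked; nothing registered depends on them.  `lean check`: rc 0, sorries 2 (S1a′, S2).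
No summit is proved by a line; S1a′, S2, ⟨26567⟩ and NS regularity are OPEN.

REV 1.3 (registered statements UNCHANGED from REV 1.2/1.1).  (a) S1b ★ LANDED: p720680 `Theorems/ExtremiserTransienceTwoThirdsExtraction.lean`
`…Theorems.NearExtremalTransiencePerFlow.TwoThirds.extremalExtraction_holds : ExtremalExtraction` (prover ns-net-p2 g11/g12; texts of record p719439
`…TwoThirdsDefs` = §2 verbatim) — `stub_extremalExtraction` is now that TERM (sorries 3 → 2: S1a, S2).  (b) §2′ AUTHORED TEXTS OF RECORD for the
LARGE-SCALE re-typing S1a′/S1b′ (`Sig.TypicalSelectionLarge`, `Sig.ExtremalExtractionLarge`): ns-net-p2 g12 found (14:02:06Z, evidence #57 on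
⟨26567⟩) that the written S1a mechanism (localised sharp inequality + `typicality_abstract`, junk `j_r ≲ C r^{-β}`) is VOID at the smallest scales
`4^i ≤ 2·4^{i₁}` (a proof-route gap, not a refutation); idea-crit-4 g9 ruled (14:07:21Z, backstop) the re-typing «`∃ i₁` BEFORE `∀ R η m`; clause (c)
only for `i₁ ≤ i < m`» ACCEPTABLE (stub-misstated-by-scope; grade untouched) since the only consumer S1b uses the scales cofinally.  AUTHOR (this
seat): NO VETO — S1a′ is adopted as the line's intended S1a; PROVED here: `Sig.typicalSelectionLarge_of` (S1a ⇒ S1a′, `i₁ = 0`) and the alternative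
composition `NearExtremalTransiencePerFlow_of_large : S1a′ → S1b′ → S2 → crux` (kernel-checked), so S1a′ ∧ S1b′ ∧ S2 already conclude ⟨26567⟩ BY NAME
in this file.  PROCEDURE (idea-crit-4 (1)): the REGISTERED stubs keep their REV 1.2 texts until S1b′ (`ExtremalExtractionLarge`, same proof as
p720680 with `max i₀ i₁`) is ACCEPTED Theorems-side; then REV 1.4 switches `stub_typicalSelection` to `Sig.TypicalSelectionLarge` and S1b to the landed
S1b′ in ONE edit — never a window with a broken composition.

REV 1.2 (REV 1.1 statements unchanged; + §3b abstract typicality PROVED) (statement CORRECTIONS of S1a/S1b/S2 found by the seat's own re-derivation before any read — both WEAKEN the inherited clauses to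
what the partition argument actually yields: (a) DOUBLING cannot be inherited at EVERY scale (hierarchical crowds make `bulk(4r)/bulk(r)` jump at a
positive fraction of scales); it is now a separate clause holding at INFINITELY MANY scales, supplied in the limit by polynomial growth + `Z ≥ b₀`
(the counting behind g9's `exists_scaleRegular`), with a free constant `D` over which S2 is uniform; (b) Chebyshev-typicality w.r.t. translated
ball packings gives good balls NEAR the thick centre (`dist c x₀ ≤ rλ/2`), not centred at it — S1a/S1b now say so; the composition is re-proved).
A CHECKED SKELETON LINE concluding the per-flow transience crux
`Summit.NavierStokesRegularity.NavierStokesRegularity.Theses.ExtremiserTransience.NearExtremalTransiencePerFlow` ⟨stmt-26567⟩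
BY NAME from THREE registered stubs (`stub_typicalSelection`, `stub_extremalExtraction`, `stub_firstOrderIdentity`); the
endgame — the «two-thirds clash» — is PROVED here (`clash`).  Filed in the crux directory of ⟨stmt-21883⟩ (this seat's write
ACL), exactly like the lines g6–g9.  HONEST FRAMING: nothing about Navier–Stokes regularity or blow-up is proved here; the
stubs carry `sorry`; no summit is proved by a line.

## The corpse and the dodge (lens «rescuer»)

CORPSE = the open heart of LINE g9-1 «local maximiser» (`Lines/local_maximiser.lean` REV 3.7): the LIMIT LIOUVILLE for the
zoom limit `V` (an analytic, divergence-free, height-`≤ 1`, linear-growth ROBUST LOCAL MAXIMISER of the linearised functional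
`F̃ = J − (κ⋆/2)(Z + W)`, class `InLimitClass`) is proved there by a HOMOGENEITY CLASH that needs SECOND-ORDER information —
an ADMISSIBLE amplitude-lowering test `−s(χV + ∇χ×ψ)` around a point of non-zero curl — and admissibility dies wherever the
cut-off crosses an INFINITE NEAR-TOP TUBE of `V` (route one: `NoPercolation`, «why it might fail: a 3-D near-top tube»;
route two: the unproved ESCAPE LEMMA + `RobustHalf`/`CompanionHalf`).  Every test-based attack meets the same wall: at a
near-top point whose velocity direction is coherent along a tube no compactly supported divergence-free field is inward.

DODGE = NEVER TEST AT CONTACT.  Two first-order / zeroth-order facts about the SAME zoom limit clash on their own: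

(E) EULER–LAGRANGE EFFICIENCY IS TWO THIRDS.  Off a nowhere-dense contact set the first variation of `F̃` vanishes on every
    curl (g9's `eulerLagrange_holds`, PROVED there; no admissibility is involved — two-sided tests live in the open slack
    set, continuity of the Euler–Lagrange density does the rest, exactly the tree's `KStar.interior_contact_nonempty`
    pattern).  Pairing the Euler–Lagrange equation with the cut-off of `V` ITSELF, `curl(χψ) = χV + ∇χ×ψ`, and using the
    cubic / quadratic homogeneity of `J` / `Z`, `W` (g9's `a1_layer`, PROVED there) gives on large balls
        `3·J_B(V) = κ⋆·(Z_B(V) + W_B(V)) + (layer terms)`,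
    and for a field of LINEAR ENERGY GROWTH the layer terms are `o(Z_B + W_B)` along doubling-regular, light-layer radii
    (gauge `|ψ| = O(log R)`, `|∇χ| ≤ R^{-7/8}`).  So an Euler–Lagrange-critical field has local `F̃`-efficiency
    `J_B / ((κ⋆/2)(Z_B + W_B)) → 2/3`.                                                        [`stub_firstOrderIdentity`]
(X) INHERITED LOCAL EXTREMALITY IS ONE.  The violator's slices are `(κ⋆ − ε_k)`-extremal GLOBALLY with `ε_k → 0`.  Cut a slice
    into cubes of side `R` (Taylor units): `J = Σ_Q J_Q`, the LOCALISED sharp inequality `J_Q ≤ κ⋆·m_Q·√(Z_Q W_Q) + junk_Q`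
    (`m_Q ≤ M` the local height; `Σ_Q junk_Q ≤ C·R^{-β}·#cells`, the zeroth-order junk being paid by LINEAR GROWTH, the
    dilute cubes by Gagliardo–Nirenberg) and Cauchy–Schwarz `Σ_Q √(Z_Q W_Q) ≤ √(Z W)` leave a total defect
    `≤ (ε_k + C R^{-β})·√(ZW)`; by Chebyshev, ENSTROPHY-MOST cubes are locally `(1 − η_R)`-EXTREMAL, reach height `≈ M`,
    and have Taylor ratio `Z_Q : λ²W_Q ≈ 1` (the Cauchy–Schwarz defect is `½Σ(√Z_Q − λ√W_Q)²`).  A centre that is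
    enstrophy-typical at all scales `4^i` simultaneously (summable exceptional weights) AND thick-good in g9's sense exists,
    and the KNSS zoom there inherits, for every `i`, a ball of radius `r_i ∈ [4^i, 2·4^i]` on which
        `J_B(V) ≥ κ⋆·√(Z_B(V) W_B(V))·(1 − K/(i+1))`,  `|W_B − Z_B| ≤ (K/(i+1))·Z_B`,
    together with a light layer (closed conditions, stable under `C²_loc` convergence), and doubling at infinitely many of these scales.
                                                                      [`stub_typicalSelection`, `stub_extremalExtraction`]
CLASH (PROVED, `clash`): `3κ⋆(1 − δ)²Z ≤ 3J ≤ κ⋆(2 + δ)Z + e(1 + 3Z)` is impossible for `Z ≥ b₀ > 0` once `δ, e` are below an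
explicit `ε₁(κ⋆, b₀)`: efficiency `1` (extremal) against efficiency `2/3` (critical).  This is the tree's non-attainment
theorem `KStar.not_attained_of_analyticOnNhd` / `KStar.interior_contact_nonempty` (an EXACT GLOBAL maximiser cannot be
Euler–Lagrange-critical off a thin contact set) transplanted TO INFINITY: exact attainment is replaced by inherited ASYMPTOTIC
LOCAL extremality at an enstrophy-typical centre — which, unlike attainment (g8 LINE «extremiser_liouville», dead at its
tightness stub K2), survives crowds, because it is local and weight-typical — and the global pairing is replaced by a cut-off
pairing whose error is `o(bulk)` by linear growth.

WHY IT IS NOT g9 AGAIN: g9 uses local MAXIMALITY at second order and needs admissible tests at contact (its whole open heart);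
this line uses only the VALUE of the local functional (zeroth order, inherited) and the Euler–Lagrange IDENTITY (first order,
proved), and never builds a test near the contact set.  WHY IT IS NOT ns-idea-5's `member_selection` / K14: those certify the
efficiency of ONE FREE centre from global slack (√N-lossy, refuted by crowd+dud); here the centre is ENSTROPHY-TYPICAL
(Chebyshev over a partition), duds carry no weight, and the localisation junk is summed, not pointwise.

## Stubs (3 registered) and what is proved

* S1a `stub_typicalSelection : Sig.TypicalSelection` (L; THE NEW LEVER, slice level) — g9's thick-good-centre `Selection`
  STRENGTHENED: under linear growth in cell units the selected centre also carries, at every scale `4^i`, `i < m`, a GOOD BALL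
  NEAR it (locally extremal, unit Taylor ratio, light layer; tolerance `K/(i+1)`; `dist c x₀ ≤ rλ/2`).
* S1b `stub_extremalExtraction : Sig.ExtremalExtraction` ★ LANDED p720680 (REV 1.3) (M; g9's L3 / the landed `extraction_holds` pattern run at the S1a
  centre, carrying the closed slice-level inequalities through the `C²_loc` zoom): every violator yields `V ∈ InLimitClass`
  with, for infinitely many `i`, a `D`-doubling good ball `B(c, r)`, `r ∈ [4^i, 2·4^i]`, tolerance `K/(i+1)`, `Z_{B(c,r)} ≥ b₀ > 0`.
* S2 `stub_firstOrderIdentity : Sig.FirstOrderIdentity` (M; g9's PROVED `eulerLagrange_holds` + `a1_layer` + the linear-growth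
  layer estimate): in the limit class, at `D`-doubling light-layer radii `R ≥ R₁(D, ε)`, `|3J_B − κ⋆(Z_B + W_B)| ≤ ε(1 + Z_B + W_B)`.
* PROVED here: `clash` (the two-thirds clash, pure real algebra), `exists_scale` (choice of the scale), and the composition
  `NearExtremalTransiencePerFlow_of : Sig.TypicalSelection → Sig.ExtremalExtraction → Sig.FirstOrderIdentity →
  NearExtremalTransiencePerFlow` (kernel-checked; concludes the crux BY NAME).

Card: `Lines/two_thirds.md` (Idea / Stubs / Hardest stub / Barriers / Transfer / Dead lines avoided / Disproof used /
Cheapest falsifier / instrument row).  Vocabulary BY NAME from the Theorems-side texts of record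
`…LocalMaximiserDefs` (`sd zd wd locGain IsTestAt`), `…LocalMaximiserLimitDefs` (`InLimitClass`), `…ZoneTransversalityDefs`
(`IsViolator`), `…BangBangCoreDefs` (`IsAdm IsReg lam`), `KStar.HalfSpace` (`E3 kStar Jst Zen Wpa`); nothing new is posited
except the ball functionals `Jb Zb Wb` and the Props below.
-/

noncomputable section

open scoped Topology InnerProductSpace RealInnerProductSpace ENNReal ContDiff
open MeasureTheory Filter Set
open Literature.Analysis.FluidPDE
open Summit.NavierStokesRegularity.NavierStokesRegularity.Theorems.DepletionLadder.KStar.HalfSpace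
open Summit.NavierStokesRegularity.NavierStokesRegularity.Theorems.DepletionLadder.KStar.BangBang
open Summit.NavierStokesRegularity.NavierStokesRegularity.Theorems.NearExtremalTransiencePerFlow.ZoneTransversality
open Summit.NavierStokesRegularity.NavierStokesRegularity.Theorems.NearExtremalTransiencePerFlow.LocalMaximiser
open Summit.NavierStokesRegularity.NavierStokesRegularity.Theses.ExtremiserTransience

namespace Summit.NavierStokesRegularity.NavierStokesRegularity.Cruxes.NearExtremalTransience.TwoThirds

-- the problem directory repeats the summit name (`NavierStokesRegularity/NavierStokesRegularity`)
set_option linter.dupNamespace false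
set_option linter.unusedVariables false

/-! ## §1 Ball functionals and good balls -/

/-- Local stretching content `J_B = ∫_{B(c,R)} ⟪ω, DV ω⟫`. -/
def Jb (V : E3 → E3) (c : E3) (R : ℝ) : ℝ := ∫ x in Metric.ball c R, sd V x

/-- Local enstrophy `Z_B = ∫_{B(c,R)} |ω|²`. -/
def Zb (V : E3 → E3) (c : E3) (R : ℝ) : ℝ := ∫ x in Metric.ball c R, zd V x

/-- Local palinstrophy `W_B = ∫_{B(c,R)} |∇ω|²`. -/
def Wb (V : E3 → E3) (c : E3) (R : ℝ) : ℝ := ∫ x in Metric.ball c R, wd V x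

theorem Zb_nonneg (V : E3 → E3) (c : E3) (R : ℝ) : 0 ≤ Zb V c R :=
  setIntegral_nonneg measurableSet_ball fun x _ => sq_nonneg _

theorem Wb_nonneg (V : E3 → E3) (c : E3) (R : ℝ) : 0 ≤ Wb V c R :=
  setIntegral_nonneg measurableSet_ball fun x _ => frobeniusNormSq_nonneg _

/-- GOOD BALL of the limit (cell units: height `1`, Taylor length `1`) with tolerance `δ`:
(i) LOCALLY EXTREMAL `κ⋆·√(Z_B W_B)·(1 − δ) ≤ J_B`; (ii) UNIT TAYLOR RATIO `|W_B − Z_B| ≤ δ·Z_B`;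
(iii) LIGHT LAYER: the shell of width `R^{7/8}` outside `B(c,R)` carries at most `δ·bulk(R)`.  All three are CLOSED
conditions in `V` (stable under `C²_loc` limits at fixed `c, R`) and all three are TYPICAL (Chebyshev) consequences of global
near-extremality — unlike doubling, which is kept apart (`IsDoubling`). -/
def IsGoodBall (V : E3 → E3) (c : E3) (R δ : ℝ) : Prop :=
  kStar * Real.sqrt (Zb V c R * Wb V c R) * (1 - δ) ≤ Jb V c R ∧
  |Wb V c R - Zb V c R| ≤ δ * Zb V c R ∧
  (Zb V c (R + R ^ (7 / 8 : ℝ)) + Wb V c (R + R ^ (7 / 8 : ℝ))) - (Zb V c R + Wb V c R) ≤ δ * (Zb V c R + Wb V c R)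

/-- DOUBLING at `(c, R)` with constant `D`: `bulk(B(c,4R)) ≤ D · bulk(B(c,R))`.  NOT inheritable at every scale (hierarchical crowds); in the
limit class it holds at infinitely many scales around a point of non-zero curl for any `D > 4⁹` by polynomial growth of the bulk and `Z ≥ b₀`
(the counting behind g9's PROVED `exists_scaleRegular`); S2 is uniform over `D`. -/
def IsDoubling (V : E3 → E3) (c : E3) (R D : ℝ) : Prop :=
  Zb V c (4 * R) + Wb V c (4 * R) ≤ D * (Zb V c R + Wb V c R)

/-- GOOD BALL of a SLICE `v` of height `M` and Taylor length `λ` around `x`, radius `r` in Taylor units (so `B(x, rλ)`),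
tolerance `δ`: the same three clauses in cell units (bulk `Z_B + λ²W_B`; the extremality clause is the restriction of the global
sharp inequality `J ≤ κ⋆ M √Z √W`, which carries no `λ`). -/
def IsGoodBallAt (v : E3 → E3) (M lam' : ℝ) (x : E3) (r δ : ℝ) : Prop :=
  kStar * M * Real.sqrt (Zb v x (r * lam') * Wb v x (r * lam')) * (1 - δ) ≤ Jb v x (r * lam') ∧
  |lam' ^ 2 * Wb v x (r * lam') - Zb v x (r * lam')| ≤ δ * Zb v x (r * lam') ∧
  (Zb v x ((r + r ^ (7 / 8 : ℝ)) * lam') + lam' ^ 2 * Wb v x ((r + r ^ (7 / 8 : ℝ)) * lam')) -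
      (Zb v x (r * lam') + lam' ^ 2 * Wb v x (r * lam')) ≤ δ * (Zb v x (r * lam') + lam' ^ 2 * Wb v x (r * lam'))

/-! ## §2 The three stub statements of REV ≤ 1.3 (S2 still registered; S1a/S1b superseded for registration by the §2′ texts S1a′/S1b′ since REV 1.4, kept as record) -/

namespace Sig

/-- S1a · TYPICAL SELECTION (L; the new lever, slice level).  In the `A`-regular admissible class with LINEAR ENERGY GROWTH in
cell units (`∫_{B(y, rλ)} |v|² ≤ A_E M² λ³ r`, Seregin's scaled energy of Type-I flows) there are `θ₀, K > 0` such that for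
every radius `R`, gain tolerance `η` and number of scales `m` some `ε₀ > 0` works: a `(κ⋆ − ε)`-extremal slice with `ε ≤ ε₀`
has a centre `x₀` which is (a) THICK `‖curl v x₀‖ ≥ θ₀ M/λ`, (b) GOOD in g9's sense (every admissible local test inside
`B(x₀, Rλ)` gains `≤ η M³`; this is the landed `Selection`), and (c) ENSTROPHY-TYPICAL AT EVERY SCALE `4^i`, `i < m`: a good
ball `IsGoodBallAt v M λ c r (K/(i+1))` of radius `r ∈ [4^i, 2·4^i]` (Taylor units) with centre NEAR `x₀` (`dist c x₀ ≤ rλ/2`,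
REV 1.1 — what typicality gives).  Route: for each translate `τ` of the packing `{B(z+τ, rλ) : z ∈ 4rλ·ℤ³}` plus its
complement, the cut-off fields `φ_B = curl(χ_B ψ)` (thin layers `ℓ = r^{7/8}λ`) are admissible, `J = Σ_B J(φ_B) + J(φ_rest) + E`
with `|E| ≲ (layer bulk + gauge junk)`, and the three DEFECTS — sharp inequality per piece `κ⋆M_B√(Z(φ_B)W(φ_B)) − J(φ_B) ≥ 0`,
height `M − M_B ≥ 0`, AM–GM `½(√Z − λ√W)² ≥ 0` per piece — sum to `≤ (ε + o_r(1))·M√Z√W`; entirely THIN pieces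
(`|ω| < θ₀M/λ`) are inefficient (g9's thin-vorticity bound) and thick pieces have `Z_B ≥ c(A,θ₀)M²λ` by `A`-regularity, so their
number is `≤ Z/(cM²λ)` and the junk sum is `o_r(1)·M√Z√W` by Cauchy–Schwarz WITHOUT any diluteness case; Chebyshev in the
`Z_B`-weight, then AVERAGING OVER `τ` and a Vitali covering turn «weight-most pieces of each packing are good» into «for
enstrophy-most points `y`, some centre within `rλ/2` of `y` carries a good ball» at each scale; union bound over `i < m`
(`ε₀` is chosen after `m`, `K`), intersected with the enstrophy-large set of thick good centres of g9's selection.  Why it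
might fail: the zeroth-order cut-off junk `∫_{layer}|v|²ℓ^{-2}` is paid by LINEAR GROWTH only (`≤ A_E M²λ³ r²/ℓ³`-type per
thick piece), and g9's `Selection` must be re-run to give an enstrophy-LARGE set of admissible centres rather than one —
both elementary but unwritten (L for length, not for risk). -/
def TypicalSelection : Prop :=
  ∀ A : ℕ → ℝ, (∀ j, 1 ≤ A j) → ∀ A_E : ℝ, 0 < A_E → ∃ θ₀ K : ℝ, 0 < θ₀ ∧ 0 < K ∧
    ∀ (R η : ℝ) (m : ℕ), 0 < R → 0 < η → ∃ ε₀ : ℝ, 0 < ε₀ ∧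
    ∀ (v : E3 → E3) (M B ε : ℝ), IsAdm v M B → IsReg A v M → 0 < Zen v → 0 < Wpa v → 0 ≤ ε → ε ≤ ε₀ →
      (kStar - ε) * M * Real.sqrt (Zen v) * Real.sqrt (Wpa v) ≤ Jst v →
      (∀ (y : E3) (r : ℝ), 0 < r → ∫ x in Metric.ball y (r * lam v), ‖v x‖ ^ 2 ≤ A_E * M ^ 2 * lam v ^ 3 * r) →
      ∃ x₀ : E3, θ₀ * M * (lam v)⁻¹ ≤ ‖curl v x₀‖ ∧
        (∀ φ : E3 → E3, IsTestAt v M φ → tsupport φ ⊆ Metric.ball x₀ (R * lam v) →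
          locGain (kStar * M) (lam v) v φ ≤ η * M ^ 3) ∧
        ∀ i : ℕ, i < m → ∃ (c : E3) (r : ℝ), dist c x₀ ≤ r * lam v / 2 ∧ (4 : ℝ) ^ i ≤ r ∧ r ≤ 2 * (4 : ℝ) ^ i ∧
          IsGoodBallAt v M (lam v) c r (K / (i + 1))

/-- S1b · EXTREMAL EXTRACTION (M).  Given the typical selection S1a, every violator flow (`IsViolator`) yields a field of the
limit class `InLimitClass A A_E` (analytic, divergence free, height `≤ 1`, derivative budget `A`, linear growth `A_E`, robust
local maximiser of `F̃` — exactly g9's L3 output, landed as `extraction_holds` at a thick good centre) which is moreover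
ASYMPTOTICALLY EXTREMAL AROUND THE ORIGIN AT INFINITELY MANY DOUBLING SCALES (REV 1.1): for every `i₀` some `i ≥ i₀`, a
centre `c` and a radius `r ∈ [4^i, 2·4^i]` with `Z_{B(c,r)} ≥ b₀ > 0`, doubling `bulk(B(c,4r)) ≤ D·bulk(B(c,r))` and a good ball
`IsGoodBall V c r (K/(i+1))`.  Route: the landed zoom (`…LocalMaximiserZoom/GainLimit/Slices/Extraction`, `extraction_holds`)
run at the S1a centre with `m = m(k) → ∞`; centres `c_i^{(k)}` (`|c| ≤ r/2` in cell units) and radii converge along a diagonal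
subsequence; the three clauses of `IsGoodBallAt` are closed under the `C²_loc` convergence of the normalised slices (`M_k = 1`,
`λ_k = 1`) and continuity of `(c,r) ↦ ∫_{B(c,r)}` — so the limit has a good ball near `0` at EVERY scale; `b₀ ≤ Z_{B(0,1/2)} ≤
Z_{B(c,r)}` from thickness `‖curl V 0‖ ≥ θ₀` and the derivative budget; DOUBLING at infinitely many of these scales with
`D = 4^{10}·…` from `b₀ ≤ bulk(B(0,ρ)) ≤ C(A)ρ³` by counting 4-adic steps (`bulk(B(c,4r)) ≤ bulk(B(0,4^{i+2}))`,
`bulk(B(c,r)) ≥ bulk(B(0,4^{i-1}))`; g9's `exists_step_ratio_le`).  Why it might fail: only book-keeping beyond the landed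
extraction (the same good times — near-efficient AND upper-locked — serve; the slice-level linear-growth constant must be the
one the landed extraction already carries into `HasLinearGrowth`). -/
def ExtremalExtraction : Prop :=
  TypicalSelection →
  ∀ (C ν T : ℝ) (u : ℝ → E3 → E3) (p : ℝ → E3 → ℝ), IsViolator C ν T u p →
    ∃ (A : ℕ → ℝ) (A_E : ℝ) (V : E3 → E3) (K b₀ D : ℝ), (∀ j, 1 ≤ A j) ∧ 0 < A_E ∧ InLimitClass A A_E V ∧
      0 < K ∧ 0 < b₀ ∧ 0 < D ∧
      ∀ i₀ : ℕ, ∃ (i : ℕ) (c : E3) (r : ℝ), i₀ ≤ i ∧ (4 : ℝ) ^ i ≤ r ∧ r ≤ 2 * (4 : ℝ) ^ i ∧ b₀ ≤ Zb V c r ∧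
        IsDoubling V c r D ∧ IsGoodBall V c r (K / (i + 1))

/-- S2 · FIRST-ORDER IDENTITY AT INFINITY (M).  For `V` in the limit class, every doubling constant `D > 0` and every `ε > 0`
there are a layer tolerance `η > 0` and a threshold `R₁` such that on every ball `B(c,R)`, `R ≥ R₁`, which is `D`-doubling
(`bulk(4R) ≤ D·bulk(R)`) and has an `η`-light layer of width `R^{7/8}`,
    `|3·J_B(V) − κ⋆·(Z_B(V) + W_B(V))| ≤ ε·(1 + Z_B(V) + W_B(V))`.
Route: the contact set `{‖V‖ = 1}` has empty interior (g9's `noPlateau_of_linearGrowth`, PROVED: analyticity + linear growth);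
hence the Euler–Lagrange identity `a₁(curl η) = 0` for every smooth compactly supported potential `η` (g9's
`eulerLagrange_holds`, PROVED — two-sided tests in the open dense slack set, continuity of the density `KStar.exists_density`);
take `η = χψ` with `χ = 1` on `B(c,R)`, `χ = 0` off `B(c, R + R^{7/8})`, `|∇ʲχ| ≲ R^{-7j/8}`, and `ψ` the vector potential of `V`
on `B(c,4R)` in the linear-growth gauge (`|ψ| ≤ C√A_E·log R` by dyadic Cauchy–Schwarz); g9's `a1_layer` (PROVED) turns
`a₁ = 0` into `3J_{χ²} − κ⋆(Z_{χ²} + W_{χ²}) = (layer integral)`; every layer term carries `∇χ` or a derivative falling on `ψ`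
and is `≤ C(A, A_E)·(R^{-5/16} log R)·(1 + bulk(4R))` after one integration by parts on the `ΔV`, `Δ²V` pairings
(every junk term is `≤ o_R(1)·(layer bulk)^{1/2}·(A_E R)^{1/2}ℓ^{-1}`-type by Cauchy–Schwarz against the light layer and
the linear-growth bound `‖∇ψ‖_{L²(B_{2R})} ≲ (A_E R)^{1/2}`, or carries `|ψ|ℓ^{-2} ≲ √A_E log R · R^{-7/4}`); doubling converts
`bulk(4R)` into `D·bulk(R)` (the `‖∇²ψ‖_{L²}`, Calderón–Zygmund, terms) and the light layer converts the weights `χ², χ³` into the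
indicator of `B(c,R)` at cost `A₁·η·bulk(R)`.  Why it might fail: the gauge bound and the layer
book-keeping are g9's `CompanionHalf` error budget at first order only (no admissibility, no flat start) — unwritten, M. -/
def FirstOrderIdentity : Prop :=
  ∀ (A : ℕ → ℝ) (A_E : ℝ) (V : E3 → E3), (∀ j, 1 ≤ A j) → 0 < A_E → InLimitClass A A_E V →
    ∀ (D ε : ℝ), 0 < D → 0 < ε → ∃ η R₁ : ℝ, 0 < η ∧ 0 < R₁ ∧ ∀ (c : E3) (R : ℝ), R₁ ≤ R → IsDoubling V c R D →
      (Zb V c (R + R ^ (7 / 8 : ℝ)) + Wb V c (R + R ^ (7 / 8 : ℝ))) - (Zb V c R + Wb V c R) ≤ η * (Zb V c R + Wb V c R) →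
      |3 * Jb V c R - kStar * (Zb V c R + Wb V c R)| ≤ ε * (1 + Zb V c R + Wb V c R)

end Sig

/-! ## §2′ TEXTS OF RECORD for the large-scale re-typing S1a′ / S1b′ (authored REV 1.3; THE REGISTERED STUB TEXTS since REV 1.4; Theorems-side copy p725367) -/

namespace Sig

/-- S1a′ · TYPICAL SELECTION AT LARGE SCALES (L; the intended text of S1a after idea-crit-4's 14:07:21Z ruling).  VERBATIM
`TypicalSelection` except that a threshold `i₁ : ℕ` is chosen right after `θ₀, K` — BEFORE `∀ R η m` and before the flow, so
`i₁ = i₁(θ₀, K; A, A_E)` cannot see `v`, `m`, `R` or `η` — and clause (c) is asked only at the scales `i₁ ≤ i < m`.  This is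
exactly the content the written mechanism proves (localised sharp inequality for `curl(χψ)` + `typicality_abstract`, whose
localisation junk `j_r ≲ C(A, A_E) r^{-β}` is small only for `r ≥ 4^{i₁}`); the dropped regime `4^i ≤ 2·4^{i₁}` was never used
downstream (S1b passes to the limit scale by scale and needs the good balls only cofinally).  NOT «S1a refuted»: ns-net-p2's
finding is a proof-route gap at small scales (clause (i)'s large-`δ` bad event = palinstrophy-poor «fat cores» with no
junk-free enstrophy bound), recorded as such. -/
def TypicalSelectionLarge : Prop :=
  ∀ A : ℕ → ℝ, (∀ j, 1 ≤ A j) → ∀ A_E : ℝ, 0 < A_E → ∃ θ₀ K : ℝ, 0 < θ₀ ∧ 0 < K ∧ ∃ i₁ : ℕ,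
    ∀ (R η : ℝ) (m : ℕ), 0 < R → 0 < η → ∃ ε₀ : ℝ, 0 < ε₀ ∧
    ∀ (v : E3 → E3) (M B ε : ℝ), IsAdm v M B → IsReg A v M → 0 < Zen v → 0 < Wpa v → 0 ≤ ε → ε ≤ ε₀ →
      (kStar - ε) * M * Real.sqrt (Zen v) * Real.sqrt (Wpa v) ≤ Jst v →
      (∀ (y : E3) (r : ℝ), 0 < r → ∫ x in Metric.ball y (r * lam v), ‖v x‖ ^ 2 ≤ A_E * M ^ 2 * lam v ^ 3 * r) →
      ∃ x₀ : E3, θ₀ * M * (lam v)⁻¹ ≤ ‖curl v x₀‖ ∧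
        (∀ φ : E3 → E3, IsTestAt v M φ → tsupport φ ⊆ Metric.ball x₀ (R * lam v) →
          locGain (kStar * M) (lam v) v φ ≤ η * M ^ 3) ∧
        ∀ i : ℕ, i₁ ≤ i → i < m → ∃ (c : E3) (r : ℝ), dist c x₀ ≤ r * lam v / 2 ∧ (4 : ℝ) ^ i ≤ r ∧
          r ≤ 2 * (4 : ℝ) ^ i ∧ IsGoodBallAt v M (lam v) c r (K / (i + 1))

/-- S1b′ · EXTREMAL EXTRACTION FROM THE LARGE-SCALE SELECTION (M).  VERBATIM the consequent of `ExtremalExtraction`, with the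
hypothesis `TypicalSelection` replaced by the weaker `TypicalSelectionLarge`; re-lands by p720680's proof with `max i₀ i₁`
(ns-net-p2 14:02:06Z; idea-crit-4 (1)). -/
def ExtremalExtractionLarge : Prop :=
  TypicalSelectionLarge →
  ∀ (C ν T : ℝ) (u : ℝ → E3 → E3) (p : ℝ → E3 → ℝ), IsViolator C ν T u p →
    ∃ (A : ℕ → ℝ) (A_E : ℝ) (V : E3 → E3) (K b₀ D : ℝ), (∀ j, 1 ≤ A j) ∧ 0 < A_E ∧ InLimitClass A A_E V ∧
      0 < K ∧ 0 < b₀ ∧ 0 < D ∧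
      ∀ i₀ : ℕ, ∃ (i : ℕ) (c : E3) (r : ℝ), i₀ ≤ i ∧ (4 : ℝ) ^ i ≤ r ∧ r ≤ 2 * (4 : ℝ) ^ i ∧ b₀ ≤ Zb V c r ∧
        IsDoubling V c r D ∧ IsGoodBall V c r (K / (i + 1))

/-- S1a ⇒ S1a′ (take `i₁ = 0`): the re-typing only WEAKENS the registered stub. -/
theorem typicalSelectionLarge_of (h : TypicalSelection) : TypicalSelectionLarge := by
  intro A hA A_E hAE
  obtain ⟨θ₀, K, hθ, hK, H⟩ := h A hA A_E hAE
  refine ⟨θ₀, K, hθ, hK, 0, fun R η m hR hη => ?_⟩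
  obtain ⟨ε₀, hε₀, H'⟩ := H R η m hR hη
  refine ⟨ε₀, hε₀, fun v M B ε h1 h2 h3 h4 h5 h6 h7 h8 => ?_⟩
  obtain ⟨x₀, hth, hg, hsc⟩ := H' v M B ε h1 h2 h3 h4 h5 h6 h7 h8
  exact ⟨x₀, hth, hg, fun i _ hi => hsc i hi⟩

/-- Conversely S1b′ ⇒ S1b given nothing (the extraction from the weaker selection is the stronger implication). -/
theorem extremalExtraction_of_large (h : ExtremalExtractionLarge) : ExtremalExtraction :=
  fun hsel => h (typicalSelectionLarge_of hsel)

end Sig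

/-! ## §3 PROVED: the two-thirds clash and the choice of scale -/

/-- **THE TWO-THIRDS CLASH** (pure real algebra).  For `κ > 0` and `b₀ > 0` there is `ε₁ > 0` such that no reals `J, Z, W` with
`Z ≥ b₀`, `W ≥ 0` can be simultaneously `δ`-EXTREMAL with `δ`-unit Taylor ratio (`κ√(ZW)(1−δ) ≤ J`, `|W − Z| ≤ δZ`) and
`e`-CRITICAL (`|3J − κ(Z + W)| ≤ e(1 + Z + W)`) when `δ, e ≤ ε₁`: the first forces `J ≳ κZ`, the second `J ≈ (2/3)κZ`. [folklore] -/
theorem clash {κ b₀ : ℝ} (hκ : 0 < κ) (hb : 0 < b₀) :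
    ∃ ε₁ : ℝ, 0 < ε₁ ∧ ∀ (J Z W δ e : ℝ), 0 ≤ δ → δ ≤ ε₁ → 0 ≤ e → e ≤ ε₁ → b₀ ≤ Z → 0 ≤ W →
      κ * Real.sqrt (Z * W) * (1 - δ) ≤ J → |W - Z| ≤ δ * Z → |3 * J - κ * (Z + W)| ≤ e * (1 + Z + W) → False := by
  refine ⟨min (1 / 100) (κ * b₀ / (2 * (1 + 3 * b₀))), lt_min (by norm_num) (by positivity), ?_⟩
  intro J Z W δ e hδ0 hδ1 he0 he1 hZ hW hext hrat hcrit
  have hδ : δ ≤ 1 / 100 := hδ1.trans (min_le_left _ _)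
  have he : e ≤ κ * b₀ / (2 * (1 + 3 * b₀)) := he1.trans (min_le_right _ _)
  have hZ0 : 0 < Z := hb.trans_le hZ
  -- Taylor ratio: (1 - δ) Z ≤ W ≤ (1 + δ) Z
  have hW1 : (1 - δ) * Z ≤ W := by
    have := (abs_le.1 hrat).1; nlinarith
  have hW2 : W ≤ (1 + δ) * Z := by
    have := (abs_le.1 hrat).2; nlinarith
  -- √(ZW) ≥ (1 - δ) Z
  have h1δ : 0 ≤ 1 - δ := by linarith
  have hsq : (1 - δ) * Z ≤ Real.sqrt (Z * W) := by
    apply Real.le_sqrt_of_sq_le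
    have : ((1 - δ) * Z) ^ 2 = (1 - δ) * ((1 - δ) * Z) * Z := by ring
    rw [this]
    have h2 : (1 - δ) * ((1 - δ) * Z) ≤ W := by nlinarith
    nlinarith
  -- extremality: J ≥ κ (1-δ)² Z
  have hJ : κ * ((1 - δ) * Z) * (1 - δ) ≤ J := by
    have : κ * ((1 - δ) * Z) * (1 - δ) ≤ κ * Real.sqrt (Z * W) * (1 - δ) :=
      mul_le_mul_of_nonneg_right (mul_le_mul_of_nonneg_left hsq hκ.le) h1δ
    exact this.trans hext
  -- criticality: 3J ≤ κ(Z+W) + e(1+Z+W)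
  have hC : 3 * J ≤ κ * (Z + W) + e * (1 + Z + W) := by
    have := (abs_le.1 hcrit).2; linarith
  -- combine: 3κ(1-δ)²Z ≤ 3J ≤ κ(2+δ)Z + e(1 + (2+δ)Z) ≤ κ(2+δ)Z + e(1+3Z)
  have hB : κ * W ≤ κ * ((1 + δ) * Z) := mul_le_mul_of_nonneg_left hW2 hκ.le
  have hCC : e * W ≤ e * ((1 + δ) * Z) := mul_le_mul_of_nonneg_left hW2 he0
  have hD : 0 ≤ e * Z * (1 - δ) := mul_nonneg (mul_nonneg he0 hZ0.le) h1δ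
  have hE : 0 ≤ κ * Z * δ ^ 2 := mul_nonneg (mul_nonneg hκ.le hZ0.le) (sq_nonneg δ)
  have hkey : κ * Z * (1 - 7 * δ) ≤ e * (1 + 3 * Z) := by linarith
  -- e(1 + 3Z) ≤ κ Z / 2 using Z ≥ b₀
  have he2 : e * (1 + 3 * Z) ≤ κ * Z / 2 := by
    have h13 : 0 < 1 + 3 * b₀ := by positivity
    have : e * (1 + 3 * Z) ≤ κ * b₀ / (2 * (1 + 3 * b₀)) * (1 + 3 * Z) :=
      mul_le_mul_of_nonneg_right he (by positivity)
    refine this.trans ?_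
    rw [div_mul_eq_mul_div, div_le_iff₀ (by positivity)]
    have := mul_le_mul_of_nonneg_left hZ hκ.le
    linarith
  have hF : 0 < κ * Z * (1 / 2 - 7 * δ) := mul_pos (mul_pos hκ hZ0) (by linarith)
  linarith

/-- Choice of the scale: an index `i` with tolerance `K/(i+1) ≤ t` and `4^i ≥ R₁`. -/
theorem exists_scale (K t R₁ : ℝ) (ht : 0 < t) : ∃ i : ℕ, K / (i + 1) ≤ t ∧ R₁ ≤ (4 : ℝ) ^ i := by
  refine ⟨⌈K / t⌉₊ + ⌈R₁⌉₊, ?_, ?_⟩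
  · have h1 : K / t ≤ (⌈K / t⌉₊ : ℝ) := Nat.le_ceil _
    have h2 : (0 : ℝ) ≤ (⌈R₁⌉₊ : ℝ) := Nat.cast_nonneg _
    have hpos : (0 : ℝ) < (⌈K / t⌉₊ + ⌈R₁⌉₊ : ℕ) + 1 := by positivity
    rw [div_le_iff₀ hpos]
    have : K ≤ t * (K / t) := by rw [mul_div_cancel₀ _ ht.ne']
    push_cast
    nlinarith
  · have h1 : R₁ ≤ (⌈R₁⌉₊ : ℝ) := Nat.le_ceil _
    have h2 : ((⌈K / t⌉₊ + ⌈R₁⌉₊ : ℕ) : ℝ) < (4 : ℝ) ^ (⌈K / t⌉₊ + ⌈R₁⌉₊) := by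
      exact_mod_cast Nat.lt_pow_self (by norm_num : 1 < 4)
    have h3 : (⌈R₁⌉₊ : ℝ) ≤ ((⌈K / t⌉₊ + ⌈R₁⌉₊ : ℕ) : ℝ) := by push_cast; linarith [(Nat.cast_nonneg (⌈K / t⌉₊) : (0:ℝ) ≤ _)]
    linarith

/-! ## §3b PROVED: abstract typicality — the finite Chebyshev–Cauchy–Schwarz core of S1a (REV 1.2)

For ONE packing (pieces `i ∈ s` = the thick balls of a translated packing plus the remainder piece, after the
cut-off junk has been absorbed into `ε`): per-piece sharp inequality + sub-additive budgets + GLOBAL near-equality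
force the enstrophy carried by pieces that are NOT good (local extremality below `1 − η`, or squared-Taylor ratio
off by more than `δ`) to be `≤ ε·(18/δ² + 2/η)·Z`.  This is exactly the accounting S1a runs at each scale `r_i`
and each translate `τ` before the `τ`-average / Vitali step; it is recorded here as a kernel theorem so that the
three-defect bookkeeping of the card (d¹ extremality, d³ ratio; d² = light layer is the `τ`-average and is not
finite combinatorics) is not in doubt.  Pointwise device: a bad piece's enstrophy is paid for either by its
Cauchy–Schwarz defect `(√Z_P − √(L·W_P))²` (ratio-bad) or by its sharp-inequality slack `κ√(Z_P W_P) − J_P`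
(extremality-bad and ratio-good), and both defect sums are globally `O(ε)`. -/

/-- Square-root defect controls the ratio: if `δ·x² < |y² − x²|` then `(x − y)² ≥ δ²x²/9`
(`x = √Z_P`, `y = √(λ² W_P)`). -/
theorem sq_defect_of_ratio_bad {x y δ : ℝ} (hx : 0 ≤ x) (hy : 0 ≤ y) (hδ : 0 < δ) (hδ1 : δ ≤ 1/2)
    (hbad : δ * x ^ 2 < |y ^ 2 - x ^ 2|) : δ ^ 2 * x ^ 2 / 9 ≤ (x - y) ^ 2 := by
  by_contra h
  push Not at h
  set d := |y - x| with hd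
  have hd0 : 0 ≤ d := abs_nonneg _
  have hdsq : d ^ 2 < (δ * x / 3) ^ 2 := by
    have : d ^ 2 = (x - y) ^ 2 := by rw [hd, sq_abs]; ring
    rw [this]; nlinarith
  have hd1 : d < δ * x / 3 := by
    exact lt_of_pow_lt_pow_left₀ 2 (by positivity) hdsq
  have hd2 : d ≤ x / 6 := by nlinarith
  have hfac : |y ^ 2 - x ^ 2| = d * (y + x) := by
    have : y ^ 2 - x ^ 2 = (y - x) * (y + x) := by ring
    rw [this, abs_mul, abs_of_nonneg (by linarith : 0 ≤ y + x)]
  have hyle : y ≤ x + d := by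
    have : y - x ≤ |y - x| := le_abs_self _
    linarith
  rw [hfac] at hbad
  have h1 : d * (y + x) ≤ d * (2 * x + d) := by
    apply mul_le_mul_of_nonneg_left _ hd0; linarith
  have h2 : d * (2 * x + d) ≤ (δ * x / 3) * (2 * x + d) :=
    mul_le_mul_of_nonneg_right hd1.le (by linarith)
  have h3 : (δ * x / 3) * (2 * x + d) ≤ (δ * x / 3) * (2 * x + x / 6) := by
    apply mul_le_mul_of_nonneg_left _ (by positivity); linarith
  nlinarith [sq_nonneg x]

/-- Pointwise accounting: the enstrophy of a BAD piece (deficient local extremality OR ratio off) is paid for by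
the piece's Cauchy–Schwarz defect `(√Z_P − √(L W_P))²` or by its sharp-inequality slack `κ√(Z_P W_P) − J_P`. -/
theorem pointwise_bad_le {κ L η δ J Z W : ℝ} (hκ : 0 < κ) (hL : 0 < L) (hη : 0 < η) (hδ : 0 < δ)
    (hδ1 : δ ≤ 1/2) (hZ : 0 ≤ Z) (hW : 0 ≤ W) (hsharp : J ≤ κ * √(Z * W)) :
    (if (J < κ * √(Z * W) * (1 - η) ∨ δ * Z < |L * W - Z|) then Z else 0)
      ≤ (9 / δ ^ 2) * (√Z - √(L * W)) ^ 2 + (√(2 * L) / (κ * η)) * (κ * √(Z * W) - J) := by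
  have hslack : 0 ≤ κ * √(Z * W) - J := by linarith
  have hA : 0 ≤ (9 / δ ^ 2) * (√Z - √(L * W)) ^ 2 := by positivity
  have hB : 0 ≤ (√(2 * L) / (κ * η)) * (κ * √(Z * W) - J) := by positivity
  split_ifs with hbad
  · rcases hbad with hext | hrat
    · -- either ratio-bad (first term pays) or ratio-good (second term pays)
      by_cases hrat : δ * Z < |L * W - Z|
      · -- ratio-bad
        have key := sq_defect_of_ratio_bad (Real.sqrt_nonneg Z) (Real.sqrt_nonneg (L * W)) hδ hδ1
          (by rw [Real.sq_sqrt hZ, Real.sq_sqrt (by positivity : (0:ℝ) ≤ L * W)]; exact hrat)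
        rw [Real.sq_sqrt hZ] at key
        have : Z ≤ (9 / δ ^ 2) * (√Z - √(L * W)) ^ 2 := by
          rw [div_mul_eq_mul_div, le_div_iff₀ (by positivity)]
          nlinarith
        linarith
      · -- ratio-good and extremality-bad
        push Not at hrat
        have hLW : Z ≤ 2 * (L * W) := by
          have := (abs_le.1 hrat).1
          nlinarith
        have hZle : Z ≤ √(2 * L) * √(Z * W) := by
          rw [← Real.sqrt_mul (by positivity)]
          have h2 : Z ^ 2 ≤ 2 * L * (Z * W) := by nlinarith
          calc Z = √(Z ^ 2) := (Real.sqrt_sq hZ).symm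
            _ ≤ √(2 * L * (Z * W)) := Real.sqrt_le_sqrt h2
        have hs : η * (κ * √(Z * W)) ≤ κ * √(Z * W) - J := by nlinarith
        have : Z ≤ (√(2 * L) / (κ * η)) * (κ * √(Z * W) - J) := by
          rw [div_mul_eq_mul_div, le_div_iff₀ (by positivity)]
          calc Z * (κ * η) = (κ * η) * Z := by ring
            _ ≤ (κ * η) * (√(2 * L) * √(Z * W)) := by
                apply mul_le_mul_of_nonneg_left hZle; positivity
            _ = √(2 * L) * (η * (κ * √(Z * W))) := by ring
            _ ≤ √(2 * L) * (κ * √(Z * W) - J) := by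
                apply mul_le_mul_of_nonneg_left hs; positivity
        linarith
    · -- ratio-bad
      have key := sq_defect_of_ratio_bad (Real.sqrt_nonneg Z) (Real.sqrt_nonneg (L * W)) hδ hδ1
        (by rw [Real.sq_sqrt hZ, Real.sq_sqrt (by positivity : (0:ℝ) ≤ L * W)]; exact hrat)
      rw [Real.sq_sqrt hZ] at key
      have : Z ≤ (9 / δ ^ 2) * (√Z - √(L * W)) ^ 2 := by
        rw [div_mul_eq_mul_div, le_div_iff₀ (by positivity)]
        nlinarith
      linarith
  · positivity

open Finset in
/-- ABSTRACT TYPICALITY (Chebyshev + Cauchy–Schwarz; the finite core of S1a).  Pieces `i ∈ s` with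
non-negative local enstrophies `Zp i`, palinstrophies `Wp i`, stretchings `Jp i ≤ κ√(Zp i · Wp i)` (sharp
inequality per piece), sub-additive budgets `Σ Zp ≤ Z`, `Σ Wp ≤ W` and GLOBAL near-equality
`κ√(ZW)(1−ε) ≤ Σ Jp`; `L = Z/W` the global squared Taylor ratio.  Then the pieces that are NOT good —
local extremality below `1 − η` OR ratio `|L·Wp − Zp| > δ·Zp` — carry at most `ε(18/δ² + 2/η)·Z` of enstrophy. -/
theorem typicality_abstract {ι : Type*} (s : Finset ι) {κ Z W L ε η δ : ℝ} (Jp Zp Wp : ι → ℝ)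
    (hκ : 0 < κ) (hZ : 0 < Z) (hW : 0 < W) (hLW : L * W = Z) (hη : 0 < η) (hδ : 0 < δ)
    (hδ1 : δ ≤ 1/2) (hZp : ∀ i ∈ s, 0 ≤ Zp i) (hWp : ∀ i ∈ s, 0 ≤ Wp i)
    (hsharp : ∀ i ∈ s, Jp i ≤ κ * √(Zp i * Wp i))
    (hsubZ : ∑ i ∈ s, Zp i ≤ Z) (hsubW : ∑ i ∈ s, Wp i ≤ W)
    (hnear : κ * √(Z * W) * (1 - ε) ≤ ∑ i ∈ s, Jp i) :
    ∑ i ∈ s.filter (fun i => Jp i < κ * √(Zp i * Wp i) * (1 - η) ∨ δ * Zp i < |L * Wp i - Zp i|), Zp i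
      ≤ ε * (18 / δ ^ 2 + 2 / η) * Z := by
  have hL : 0 < L := by
    by_contra h; push Not at h; nlinarith
  -- Cauchy–Schwarz: S := Σ √Zp √Wp ≤ √Z √W
  set S := ∑ i ∈ s, √(Zp i * Wp i) with hS
  have hS0 : 0 ≤ S := sum_nonneg fun i _ => Real.sqrt_nonneg _
  have hSeq : S = ∑ i ∈ s, √(Zp i) * √(Wp i) := by
    rw [hS]; exact sum_congr rfl fun i hi => Real.sqrt_mul (hZp i hi) _
  have hCS : S ^ 2 ≤ Z * W := by
    rw [hSeq]
    calc (∑ i ∈ s, √(Zp i) * √(Wp i)) ^ 2 ≤ (∑ i ∈ s, √(Zp i) ^ 2) * (∑ i ∈ s, √(Wp i) ^ 2) :=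
          sum_mul_sq_le_sq_mul_sq s _ _
      _ = (∑ i ∈ s, Zp i) * (∑ i ∈ s, Wp i) := by
          congr 1
          · exact sum_congr rfl fun i hi => Real.sq_sqrt (hZp i hi)
          · exact sum_congr rfl fun i hi => Real.sq_sqrt (hWp i hi)
      _ ≤ Z * W := mul_le_mul hsubZ hsubW (sum_nonneg hWp) hZ.le
  have hSle : S ≤ √(Z * W) := by
    calc S = √(S ^ 2) := (Real.sqrt_sq hS0).symm
      _ ≤ √(Z * W) := Real.sqrt_le_sqrt hCS
  -- lower bound on S from near-equality and the sharp inequality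
  have hJle : ∑ i ∈ s, Jp i ≤ κ * S := by
    rw [hS, mul_sum]; exact sum_le_sum hsharp
  have hSge : κ * √(Z * W) * (1 - ε) ≤ κ * S := le_trans hnear hJle
  have hκS : κ * S ≤ κ * √(Z * W) := mul_le_mul_of_nonneg_left hSle hκ.le
  have hZWpos : 0 < κ * √(Z * W) := by positivity
  have hε0 : 0 ≤ ε := by
    by_contra hneg; push Not at hneg
    nlinarith [mul_pos hZWpos (neg_pos.2 hneg)]
  have hS1 : √(Z * W) * (1 - ε) ≤ S := by
    have h' : κ * (√(Z * W) * (1 - ε)) ≤ κ * S := by rw [← mul_assoc]; exact hSge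
    exact le_of_mul_le_mul_left h' hκ
  -- the key identity √L · √(ZW) = Z
  have hLZW : √L * √(Z * W) = Z := by
    rw [← Real.sqrt_mul hL.le, show L * (Z * W) = Z * Z by rw [← hLW]; ring]
    exact Real.sqrt_mul_self hZ.le
  -- ε ≥ 0 is forced unless the sum is empty-ish; we derive what we need: εκ√(ZW) ≥ κ√(ZW) − κS ≥ 0
  have hεZW : κ * √(Z * W) - κ * S ≤ ε * (κ * √(Z * W)) := by nlinarith
  have hslack_sum : ∑ i ∈ s, (κ * √(Zp i * Wp i) - Jp i) ≤ ε * (κ * √(Z * W)) := by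
    rw [sum_sub_distrib, ← mul_sum, ← hS]; linarith [hκS, hnear]
  -- the CS-defect sum
  have hdef_sum : ∑ i ∈ s, (√(Zp i) - √(L * Wp i)) ^ 2 ≤ 2 * ε * Z := by
    have hexp : ∀ i ∈ s, (√(Zp i) - √(L * Wp i)) ^ 2 = Zp i + L * Wp i - 2 * (√L * √(Zp i * Wp i)) := by
      intro i hi
      have h1 : √(L * Wp i) = √L * √(Wp i) := Real.sqrt_mul hL.le _
      have h2 : √(Zp i * Wp i) = √(Zp i) * √(Wp i) := Real.sqrt_mul (hZp i hi) _
      rw [h1, h2, sub_sq, Real.sq_sqrt (hZp i hi), mul_pow, Real.sq_sqrt hL.le, Real.sq_sqrt (hWp i hi)]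
      ring
    rw [sum_congr rfl hexp, sum_sub_distrib, sum_add_distrib, ← mul_sum, ← mul_sum, ← mul_sum, ← hS]
    have hSZ : (1 - ε) * Z ≤ √L * S := by
      have h1 := mul_le_mul_of_nonneg_left hS1 (Real.sqrt_nonneg L)
      have e : √L * (√(Z * W) * (1 - ε)) = Z * (1 - ε) := by rw [← mul_assoc, hLZW]
      linarith
    have hLWs : L * ∑ i ∈ s, Wp i ≤ Z := by
      calc L * ∑ i ∈ s, Wp i ≤ L * W := mul_le_mul_of_nonneg_left hsubW hL.le
        _ = Z := hLW
    linarith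
  -- pointwise accounting summed
  have hpt : ∀ i ∈ s, (if (Jp i < κ * √(Zp i * Wp i) * (1 - η) ∨ δ * Zp i < |L * Wp i - Zp i|) then Zp i else 0)
      ≤ (9 / δ ^ 2) * (√(Zp i) - √(L * Wp i)) ^ 2 + (√(2 * L) / (κ * η)) * (κ * √(Zp i * Wp i) - Jp i) :=
    fun i hi => pointwise_bad_le hκ hL hη hδ hδ1 (hZp i hi) (hWp i hi) (hsharp i hi)
  have h2LZ : √(2 * L) * √(Z * W) ≤ 2 * Z := by
    rw [← Real.sqrt_mul (by positivity : (0:ℝ) ≤ 2 * L)]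
    have e : 2 * L * (Z * W) = 2 * Z ^ 2 := by
      calc 2 * L * (Z * W) = 2 * Z * (L * W) := by ring
        _ = 2 * Z ^ 2 := by rw [hLW]; ring
    calc √(2 * L * (Z * W)) = √(2 * Z ^ 2) := by rw [e]
      _ ≤ √((2 * Z) ^ 2) := Real.sqrt_le_sqrt (by nlinarith)
      _ = 2 * Z := Real.sqrt_sq (by positivity)
  have T1 : (9 / δ ^ 2) * ∑ i ∈ s, (√(Zp i) - √(L * Wp i)) ^ 2 ≤ ε * (18 / δ ^ 2) * Z := by
    calc (9 / δ ^ 2) * ∑ i ∈ s, (√(Zp i) - √(L * Wp i)) ^ 2 ≤ (9 / δ ^ 2) * (2 * ε * Z) :=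
          mul_le_mul_of_nonneg_left hdef_sum (by positivity)
      _ = ε * (18 / δ ^ 2) * Z := by ring
  have T2 : (√(2 * L) / (κ * η)) * ∑ i ∈ s, (κ * √(Zp i * Wp i) - Jp i) ≤ ε * (2 / η) * Z := by
    calc (√(2 * L) / (κ * η)) * ∑ i ∈ s, (κ * √(Zp i * Wp i) - Jp i)
        ≤ (√(2 * L) / (κ * η)) * (ε * (κ * √(Z * W))) :=
          mul_le_mul_of_nonneg_left hslack_sum (by positivity)
      _ = (ε / η) * (√(2 * L) * √(Z * W)) * (κ / κ) := by ring
      _ = (ε / η) * (√(2 * L) * √(Z * W)) := by rw [div_self hκ.ne', mul_one]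
      _ ≤ (ε / η) * (2 * Z) := mul_le_mul_of_nonneg_left h2LZ (by positivity)
      _ = ε * (2 / η) * Z := by ring
  rw [Finset.sum_filter]
  refine le_trans (Finset.sum_le_sum hpt) ?_
  rw [Finset.sum_add_distrib, ← Finset.mul_sum, ← Finset.mul_sum]
  calc (9 / δ ^ 2) * ∑ i ∈ s, (√(Zp i) - √(L * Wp i)) ^ 2
        + (√(2 * L) / (κ * η)) * ∑ i ∈ s, (κ * √(Zp i * Wp i) - Jp i)
      ≤ ε * (18 / δ ^ 2) * Z + ε * (2 / η) * Z := add_le_add T1 T2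
    _ = ε * (18 / δ ^ 2 + 2 / η) * Z := by ring

/-! ## §4 PROVED: the composition — the crux BY NAME from the three stubs -/

/-- **THE SKELETON.** `NearExtremalTransiencePerFlow` ⟨stmt-26567⟩ BY NAME: a violator would produce (S1a → S1b) an analytic
linear-growth local maximiser that is asymptotically extremal around the origin at infinitely many doubling scales; at a large
such scale the inherited extremality (efficiency `1`) and the first-order identity S2 (efficiency `2/3`) contradict each other
(`clash`). -/
theorem NearExtremalTransiencePerFlow_of (h1 : Sig.TypicalSelection) (h2 : Sig.ExtremalExtraction)
    (h3 : Sig.FirstOrderIdentity) : NearExtremalTransiencePerFlow := by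
  intro C ν T hC hν hT u p hsol hLH hdec hrate hsing
  by_contra hno
  have hviol : IsViolator C ν T u p := ⟨hC, hν, hT, hsol, hLH, hdec, hrate, hsing, hno⟩
  obtain ⟨A, A_E, V, K, b₀, D, hA, hAE, hV, hK, hb₀, hD, hgood⟩ := h2 h1 C ν T u p hviol
  obtain ⟨ε₁, hε₁, hcl⟩ := clash kStar_pos hb₀
  obtain ⟨η, R₁, hη, hR₁, hid⟩ := h3 A A_E V hA hAE hV D ε₁ hD hε₁
  obtain ⟨i₀, hi₀, hi₀R⟩ := exists_scale K (min ε₁ η) R₁ (lt_min hε₁ hη)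
  obtain ⟨i, c, r, hii, hr1, hr2, hbr, hdbl, hext, hrat, hlay⟩ := hgood i₀
  -- the tolerance only improves and the radius only grows beyond the chosen scale `i₀`
  have hi : K / (i + 1) ≤ min ε₁ η := by
    refine le_trans ?_ hi₀
    exact div_le_div_of_nonneg_left hK.le (by positivity) (by exact_mod_cast Nat.succ_le_succ hii)
  have hiR : R₁ ≤ (4 : ℝ) ^ i := hi₀R.trans (pow_le_pow_right₀ (by norm_num) hii)
  have hδ0 : 0 ≤ K / (i + 1) := div_nonneg hK.le (by positivity)
  have hδε : K / (i + 1) ≤ ε₁ := hi.trans (min_le_left _ _)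
  have hδη : K / (i + 1) ≤ η := hi.trans (min_le_right _ _)
  have hbulk0 : 0 ≤ Zb V c r + Wb V c r := add_nonneg (Zb_nonneg V c r) (Wb_nonneg V c r)
  have hlay' : (Zb V c (r + r ^ (7 / 8 : ℝ)) + Wb V c (r + r ^ (7 / 8 : ℝ))) - (Zb V c r + Wb V c r)
      ≤ η * (Zb V c r + Wb V c r) := hlay.trans (mul_le_mul_of_nonneg_right hδη hbulk0)
  have hidr := hid c r (hiR.trans hr1) hdbl hlay'
  exact hcl (Jb V c r) (Zb V c r) (Wb V c r) (K / (i + 1)) ε₁ hδ0 hδε hε₁.le le_rfl hbr (Wb_nonneg V c r) hext hrat hidr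

/-- **THE SKELETON AFTER THE RULED RE-TYPING (REV 1.3, kernel-checked):** the crux BY NAME from S1a′, S1b′ and S2 — the same
proof; documents that switching the registered stubs to the large-scale texts (REV 1.4, after S1b′ lands) costs nothing. -/
theorem NearExtremalTransiencePerFlow_of_large (h1 : Sig.TypicalSelectionLarge) (h2 : Sig.ExtremalExtractionLarge)
    (h3 : Sig.FirstOrderIdentity) : NearExtremalTransiencePerFlow := by
  intro C ν T hC hν hT u p hsol hLH hdec hrate hsing
  by_contra hno
  have hviol : IsViolator C ν T u p := ⟨hC, hν, hT, hsol, hLH, hdec, hrate, hsing, hno⟩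
  obtain ⟨A, A_E, V, K, b₀, D, hA, hAE, hV, hK, hb₀, hD, hgood⟩ := h2 h1 C ν T u p hviol
  obtain ⟨ε₁, hε₁, hcl⟩ := clash kStar_pos hb₀
  obtain ⟨η, R₁, hη, hR₁, hid⟩ := h3 A A_E V hA hAE hV D ε₁ hD hε₁
  obtain ⟨i₀, hi₀, hi₀R⟩ := exists_scale K (min ε₁ η) R₁ (lt_min hε₁ hη)
  obtain ⟨i, c, r, hii, hr1, hr2, hbr, hdbl, hext, hrat, hlay⟩ := hgood i₀
  -- the tolerance only improves and the radius only grows beyond the chosen scale `i₀`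
  have hi : K / (i + 1) ≤ min ε₁ η := by
    refine le_trans ?_ hi₀
    exact div_le_div_of_nonneg_left hK.le (by positivity) (by exact_mod_cast Nat.succ_le_succ hii)
  have hiR : R₁ ≤ (4 : ℝ) ^ i := hi₀R.trans (pow_le_pow_right₀ (by norm_num) hii)
  have hδ0 : 0 ≤ K / (i + 1) := div_nonneg hK.le (by positivity)
  have hδε : K / (i + 1) ≤ ε₁ := hi.trans (min_le_left _ _)
  have hδη : K / (i + 1) ≤ η := hi.trans (min_le_right _ _)
  have hbulk0 : 0 ≤ Zb V c r + Wb V c r := add_nonneg (Zb_nonneg V c r) (Wb_nonneg V c r)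
  have hlay' : (Zb V c (r + r ^ (7 / 8 : ℝ)) + Wb V c (r + r ^ (7 / 8 : ℝ))) - (Zb V c r + Wb V c r)
      ≤ η * (Zb V c r + Wb V c r) := hlay.trans (mul_le_mul_of_nonneg_right hδη hbulk0)
  have hidr := hid c r (hiR.trans hr1) hdbl hlay'
  exact hcl (Jb V c r) (Zb V c r) (Wb V c r) (K / (i + 1)) ε₁ hδ0 hδε hε₁.le le_rfl hbr (Wb_nonneg V c r) hext hrat hidr
/-! ## §5 The registered stubs (REV 1.4: S1a′ / S1b′ texts of §2′; S2 unchanged) -/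

/-- STUB S1a′ (L; the new lever; REGISTERED TEXT since REV 1.4 = `Sig.TypicalSelectionLarge`, Theorems-side copy p725367
`…TwoThirds.TypicalSelectionLarge`): typical selection — thick, good AND enstrophy-typical at every LARGE scale `i₁ ≤ i < m`, the threshold
`i₁ = i₁(θ₀, K; A, A_E)` chosen before the flow.  (The REV ≤ 1.3 text `Sig.TypicalSelection` is the case `i₁ = 0` and implies this one:
`Sig.typicalSelectionLarge_of`.)  Open; target of the ns-net-p2 lineage (bricks p724235/p724236/p724270/p724691/p725193/p726086/p726088). -/
theorem stub_typicalSelection : Sig.TypicalSelectionLarge := by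
  sorry

/-- S1b′ (M) — ★ LANDED BY NAME (REV 1.4): p726488 `Theorems/ExtremiserTransienceTwoThirdsExtractionLarge.lean`
`…TwoThirds.extremalExtractionLarge : ExtremalExtractionLarge` (prover ns-net-p2 g12, std axioms), whose type is the Theorems-side text of
record p725367 = `Sig.ExtremalExtractionLarge` VERBATIM (definitionally equal; token-compare CONFORM by idea-crit-4 g10).  Extraction of an
asymptotically extremal analytic local maximiser from a violator, given typical selection at large scales. -/
theorem stub_extremalExtraction : Sig.ExtremalExtractionLarge :=
  Summit.NavierStokesRegularity.NavierStokesRegularity.Theorems.NearExtremalTransiencePerFlow.TwoThirds.extremalExtractionLarge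

/-- STUB S2 (M): the first-order (Euler–Lagrange) identity at infinity, `3J_B = κ⋆(Z_B + W_B) + o(bulk)`. -/
theorem stub_firstOrderIdentity : Sig.FirstOrderIdentity := by
  sorry

/-- Alias under the primed name used on the provers' board (S1a′). -/
theorem stub_typicalSelection' : Sig.TypicalSelectionLarge := stub_typicalSelection

/-- Alias under the primed name used on the provers' board (S1b′, landed). -/
theorem stub_extremalExtraction' : Sig.ExtremalExtractionLarge := stub_extremalExtraction

/-- RECORD (not registered): the REV 1.3 landing of the STRONGER-hypothesis S1b — p720680 `extremalExtraction_holds : ExtremalExtraction`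
(type = `Sig.ExtremalExtraction` verbatim).  Also derivable from S1b′: `Sig.extremalExtraction_of_large stub_extremalExtraction`. -/
theorem extremalExtraction_landed : Sig.ExtremalExtraction :=
  Summit.NavierStokesRegularity.NavierStokesRegularity.Theorems.NearExtremalTransiencePerFlow.TwoThirds.extremalExtraction_holds

/-- The skeleton with the registered stubs plugged in (REV 1.4: the LARGE-SCALE composition; contains the `sorry`s of S1a′ and S2). -/
theorem NearExtremalTransiencePerFlow_skeleton : NearExtremalTransiencePerFlow :=
  NearExtremalTransiencePerFlow_of_large stub_typicalSelection stub_extremalExtraction stub_firstOrderIdentity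

end Summit.NavierStokesRegularity.NavierStokesRegularity.Cruxes.NearExtremalTransience.TwoThirds

end
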